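import Summits.KontsevichZagierPeriods.KontsevichZagierPeriods.Theorems.ResidualBeyondGenusZero.Negative.RuleTwoLoadBearing

/-!
# `ResidualBeyondGenusZero` (stmt-KontsevichZagierPeriods-3917): negative side, V — the rule-(2) witness is one move

Companion of `RuleTwoLoadBearing.lean`: the vanishing combination `[W₁] − [W₂]` used there
(`W₁ = [[3,4], 1/(t−5)]`, `W₂ = [[0,1], 1/(t−2)]`) is a single change-of-variables move
`z ↦ z − 3` of the full calculus (`of_repW₁_sub_of_repW₂_mem_changeOfVariablesRel`), hence a
relation. Together with `residual_false_without_changeOfVariables` this isolates rule (2) exactly: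
one instance of rule (2) is not a consequence of (1a)+(1b)+(3) plus all genus-zero classes.
Source for the rules: M. Kontsevich, D. Zagier, *Periods* (2001), §1.2. -/

noncomputable section

open MeasureTheory Set
open Literature.NumberTheory.Transcendental

namespace Summit.KontsevichZagierPeriods.ResidualBeyondGenusZero.Negative

/-- **The witness is ONE move in the full calculus**: `[W₁] − [W₂]` is the change of variables
`z ↦ z − 3` (rule (2)). So §7.7 isolates rule (2) exactly. -/
theorem of_repW₁_sub_of_repW₂_mem_changeOfVariablesRel :
    KZ.of repW₁ - KZ.of repW₂ ∈ KZ.changeOfVariablesRel := by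
  refine ⟨1, repW₁, repW₂, fun z => z - fun _ => (3 : ℝ), fun _ => ContinuousLinearMap.id ℝ (Fin 1 → ℝ),
    ?_, ?_, ?_, ?_, ?_, rfl⟩
  · refine (isSemialgebraicMapOn_aeval repW₁.isSemialgebraic_domain
      (fun _ => MvPolynomial.X 0 - MvPolynomial.C 3 : Fin 1 → MvPolynomial (Fin 1) ℚ)).congr
      fun z _ => ?_
    funext j
    rw [Fin.fin_one_eq_zero j]
    simp
  · intro z _
    exact ((hasFDerivAt_id z).sub_const (fun _ : Fin 1 => (3 : ℝ))).hasFDerivWithinAt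
  · intro z _ w _ h
    exact sub_left_injective h
  · ext w
    simp only [repW₁, repW₂, invRep_domain, mem_image, mem_setOf_eq, mem_Icc]
    push_cast
    constructor
    · intro hw
      refine ⟨fun _ => w 0 + 3, ⟨by linarith [hw.1], by linarith [hw.2]⟩, ?_⟩
      funext j
      rw [Fin.fin_one_eq_zero j, Pi.sub_apply]
      ring
    · rintro ⟨z, hz, rfl⟩
      rw [Pi.sub_apply]
      constructor <;> linarith [hz.1, hz.2]
  · intro z _
    rw [repW₁, repW₂, invRep_integrand, invRep_integrand]
    simp only [Pi.sub_apply, ContinuousLinearMap.det, ContinuousLinearMap.coe_id, LinearMap.det_id,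
      abs_one, mul_one]
    push_cast
    ring

/-- Hence `[W₁] − [W₂] ∈ KZ.relations` (the value equality is one rule-(2) move). -/
theorem of_repW₁_sub_of_repW₂_mem_relations : KZ.of repW₁ - KZ.of repW₂ ∈ KZ.relations :=
  KZ.changeOfVariablesRel_subset_relations of_repW₁_sub_of_repW₂_mem_changeOfVariablesRel

end Summit.KontsevichZagierPeriods.ResidualBeyondGenusZero.Negative
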